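import Literature.AlgebraicGeometry.HodgeTheory.MiddleDimensionReductionHolds
import Literature.AlgebraicGeometry.HodgeTheory.IsoTransport
import Literature.AlgebraicGeometry.HodgeTheory.ProductFactorsHodgeDescent
import Literature.AlgebraicGeometry.HodgeTheory.HodgeTypeExteriorProduct
import Literature.AlgebraicGeometry.HodgeTheory.DominatedByPowersHodgeConjectureHolds
import Literature.AlgebraicGeometry.HodgeTheory.ComplexGysin
import Summits.HodgeConjecture.HodgeConjecture.Theorems.SoloBlindMiddleMonotone
import Summits.HodgeConjecture.HodgeConjecture.Statement
import HarnessLib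

/-!
# The square form of the summit: `HodgeConjecture ⟺` the Hodge conjecture for `X × X` in degree `2 dim X`

Solo-blind residency on `HodgeConjecture`, session s175; claims SB-C1342 – SB-C1344 of its
`CLAIMS.jsonl`, companion prose `work/s175/square175.md`, front sheet `paper/sharpest.md` §1 (1j).

A KERNEL COROLLARY of theorems already in the tree, recorded at summit level. `SquareHodge N`: for
every smooth projective complex `N`-fold `X`, every rational class of Hodge type `(N, N)` in
`H^{2N}((X × X)(ℂ); ℂ)` is algebraic — the degree of the Künneth components
`Hⁱ(X) ⊗ H^{2N-i}(X) ≅ End(H^{2N-i}(X))(-N)` (Poincaré duality), so `SquareHodge N` says: every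
Hodge class among the DEGREE-PRESERVING SELF-CORRESPONDENCES of an `N`-fold is algebraic (this
reading is not formalised here). THEOREM (`hodgeConjecture_iff_forall_squareHodge`):
`HodgeConjecture ↔ ∀ N, SquareHodge N`; finer (`hodgeConjectureFor_of_squareHodge`,
`mem_algebraicClasses_of_squareHodge`): `SquareHodge N` alone gives the Hodge conjecture for every
smooth projective variety of dimension `≤ N/2`, and in codimension `p` on `d`-folds whenever
`d + p ≤ N`; so (`middleHodge_of_squareHodge`) `SquareHodge (3m) → MiddleHodge m`, and
(`hodgeConjecture_iff_frequently_squareHodge`) the summit follows from `SquareHodge N` for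
infinitely many `N`. `SquareHodge 0`, `SquareHodge 1` are theorems (`squareHodge_of_le_one`); the
first open level is `N = 2`, the `(2,2)`-classes on self-products `S × S` of surfaces (which contain
the Hodge classes of `End(H²(S))`, i.e. the endomorphisms of the transcendental Hodge structure).

Proof of `SquareHodge (d + p) ⟹` "rational `(p,p)`-classes on `d`-folds are algebraic"
(`mem_algebraicClasses_of_square`). Let `c` be a rational `(p,p)`-class on the smooth projective
`d`-fold `Y`, `d ≥ 1` (`d = 0`: `Arapura2006.hodgeConjectureFor_of_dim_zero`), and `T` ANY smooth projective
`p`-fold (`T = ℙᵖ` in the corollaries). Put `X = Y × T` (an `N`-fold, `N = d + p`) and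
`W = (X × T) × Y ≅ X × X` (`τ = α ≪≫ X ◁ β`: associator and braiding of the cartesian monoidal
structure of `Sch/ℂ`).
* transport (`forall_hodgeClass_mem_algebraicClasses_iff_of_iso`): the hypothesis for `X × X` in
  degree `2N` is the same statement for `W` in degree `2N = 2(p + d)`;
* product step at the LAST factor `Y` of `W = (X × T) × Y`
  (`mem_algebraicClasses_of_prod_of_topDegree` — the product half of Brosnan–Fang–Nie–Pearlstein's
  Lemma 48 with its `ℙʳ` replaced by an arbitrary smooth projective `r`-fold `P`, `r ≥ 1`: for a
  rational `(q,q)`-class `a` on `V` and `ρ ≠ 0` a rational top-degree class of `P`,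
  `a = λ⁻¹ · pr_{1*}(pr₁^* a ∪ pr₂^* ρ)` with `λ ≠ 0`, so `a` is algebraic once the rational
  `(q + r, q + r)`-classes on `V × P` are): the rational `(p,p)`-class `a = pr₁^* pr₁^* c` on the
  `(N + p)`-fold `X × T` is algebraic, its degree-`2(p + d)` partner on `W` being algebraic by the
  transported hypothesis (degree budget: `2p + 2d = 2N`, which is why `dim T = p`);
* descent along the two first projections (`mem_algebraicClasses_left_of_map_fst_mem`, twice:
  `pr₁^* x` algebraic `⟹ x` algebraic): `pr₁^* c` on `X = Y × T`, then `c` on `Y`, is algebraic.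
For `d + p < N` first replace `Y` by `Y × ℙ^{N-d-p}` (descent once more). The converse direction is
the specialisation of the Hodge conjecture to `X × X` (`IsSmoothProjective.tensor_holds`).

What it buys (bookkeeping — a kernel-checked NORMAL FORM of the summit, not a reduction of
difficulty): the Hodge conjecture is a statement about ONE cohomology group per variety, the middle
cohomology of its square. Compare the tree's `middleDimensionReduction_holds` (all
even-dimensional varieties, middle degree) and `SoloBlindMiddleDegree` / `SoloBlindMiddleMonotone`
(the chain `MiddleHodge m`; `MiddleHodge N → SquareHodge N → MiddleHodge m` for `3m ≤ N`,
`squareHodge_of_middleHodge` / `middleHodge_of_squareHodge`): here the test varieties are squares.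

## References

* [BrosnanFangNiePearlstein2009] P. Brosnan, H. Fang, Z. Nie, G. Pearlstein, Singularities of
  admissible normal functions, Invent. Math. 177 (2009), §6 Lemma 48 (arXiv:0711.0964, p. 13).
* [VoisinHodgeI2002] C. Voisin, Hodge Theory and Complex Algebraic Geometry I (2002), §7.3.2,
  §11.3.2 Thm. 11.38, §11.3.3 Lemma 11.41.
* [Deligne2000] P. Deligne, The Hodge conjecture, Clay problem description (2000), §1.
-/

noncomputable section

open scoped Manifold ContDiff
open CategoryTheory CategoryTheory.Limits AlgebraicGeometry MonoidalCategory CartesianMonoidalCategory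
open Literature.AlgebraicGeometry Literature.AlgebraicGeometry.Motives
open Literature.AlgebraicGeometry.HodgeTheory
open Literature.AlgebraicTopology.SingularHomology

namespace Summit.HodgeConjecture.HodgeConjecture.Theorems.SoloBlind

/-- **The product step of BFNP Lemma 48 at an arbitrary auxiliary factor.** Let `X` be smooth
projective of dimension `n`, `P` smooth projective of dimension `r ≥ 1`, and `c ∈ H²ᵖ(X(ℂ); ℂ)` a
rational `(p, p)`-class; suppose every rational `(p + r, p + r)`-class of degree `2(p + r)` on
`X × P` is algebraic. Then `c` is algebraic: with `ρ ≠ 0` a rational top-degree class of `P`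
(`exists_isRationalClass_ne_zero_of_degree_eq_two_mul`; of type `(r, r)`), `c' = pr₁^* c ∪ pr₂^* ρ`
is a rational `(p + r, p + r)`-class on `X × P`, hence algebraic, so `pr_{1*} c'` is algebraic
(`complexGysin_mem_supportedClasses`), and `pr_{1*} c' = λ c` with `λ ≠ 0` (`pr₂^* ρ` dies off a
slice `X × {t}`, hence is `λ · s_{t*} 1`, and `λ ≠ 0` because `pr₂` has a section). This is
`mem_algebraicClasses_of_middle_of_prod_projectiveSpace` (`SoloBlindMiddleMonotone`; the tree's
`mem_algebraicClasses_of_two_mul_add_eq_of_cupPreservesHodgeType`) with `ℙʳ` replaced by `P` and the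
dimension constraint `n = 2p + r` dropped — same proof, verbatim; the indices `q = p + r`,
`N = n + r` are taken as free parameters for the callers' convenience.
[cite: BrosnanFangNiePearlstein2009, §6 Lemma 48 (proof, case dim Y < 2k)]
[cite: VoisinHodgeI2002, §7.3.2 and §11.1.2] -/
theorem mem_algebraicClasses_of_prod_of_topDegree
    {n : ℕ} {X : Motives.SchemeOver ℂ} (hX : Motives.IsSmoothProjective n X)
    {r : ℕ} {P : Motives.SchemeOver ℂ} (hP : Motives.IsSmoothProjective r P) (hr1 : 1 ≤ r)
    {p q N : ℕ} (hq : p + r = q) (hN : n + r = N)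
    (hprod : ∀ c' : complexBetti (X ⊗ P) (2 * q), IsRationalClass c' →
      IsOfHodgeType N (X ⊗ P) (2 * q) q q c' → c' ∈ algebraicClasses (X ⊗ P) q)
    (c : complexBetti X (2 * p)) (hc : IsRationalClass c)
    (hpp : IsOfHodgeType n X (2 * p) p p c) : c ∈ algebraicClasses X p := by
  subst hq hN
  -- an orientation family (orientations of the closed manifolds `Y(ℂ)` exist) and its duality
  let μ : OrientationFamily := fun n Y hY ↦ (Motives.ComplexPoints.isOrientableOver ℂ hY).some
  have hμ : μ.HasPoincareDuality := OrientationFamily.hasPoincareDuality μ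
  have hS := gysinMap_restrictCompl_eq_zero_of_field.{0, 0} ℂ
  -- a complex point `t` of `P`, a complex point `x₀` of `X`, the product `V = X × P`
  haveI := connectedSpace_complexPoints hP
  obtain ⟨t⟩ : Nonempty (Motives.ComplexPoints P) := inferInstance
  haveI := connectedSpace_complexPoints hX
  obtain ⟨x₀⟩ : Nonempty (Motives.ComplexPoints X) := inferInstance
  have hV : Motives.IsSmoothProjective (n + r) (X ⊗ P) := Motives.IsSmoothProjective.tensor_holds hX hP
  haveI : LocallyOfFiniteType P.hom := locallyOfFiniteType_of_isSmoothProjective hP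
  haveI : IsClosedImmersion (Motives.sliceAt X t).left := Motives.isClosedImmersion_sliceAt_left t
  haveI := pathConnectedSpace_complexPoints hX
  -- a non-zero rational top-degree class `ρ` on `P`, of type `(r, r)`
  obtain ⟨ρ, hρ, hρ0⟩ := exists_isRationalClass_ne_zero_of_degree_eq_two_mul hP
  obtain ⟨B⟩ := nonempty_hodgeModel_holds (n := r) (X := P) hP
  have hρtyp : IsOfHodgeType r P (2 * r) r r ρ := isOfHodgeType_of_degree_eq_two_mul B ρ
  -- `pr₂^* ρ` dies off the slice `s_t(X) = pr₂⁻¹(t)` …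
  have hρsupp : complexBetti.restrictCompl (X ⊗ P) (Set.range (Motives.sliceAt X t).left.base)
      (2 * r) (complexBetti.map (snd X P) (2 * r) ρ) = 0 := by
    rw [range_sliceAt_left_base]
    exact complexBetti.restrictCompl_map_eq_zero (snd X P) (restrictCompl_pt_eq_zero hP hr1 t ρ)
  -- … hence is a Gysin image `s_{t*} y`, `y ∈ H⁰(X(ℂ); ℂ) = ℂ · 1`: `pr₂^* ρ = λ · s_{t*} 1`
  obtain ⟨y, hy⟩ := exists_complexGysin_eq_of_isClosedImmersion μ hV hX (Motives.sliceAt X t)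
    (show 0 + 2 * (n + r) = 2 * r + 2 * n by ring) hρsupp
  obtain ⟨lam, rfl⟩ := singularCohomology.exists_eq_smul_one y
  rw [map_smul] at hy
  -- `λ ≠ 0`: `pr₂^*` is injective (`pr₂` has the section `(x₀, 𝟙)`) and `ρ ≠ 0`
  have hlam : lam ≠ 0 := by
    rintro rfl
    rw [zero_smul] at hy
    apply hρ0
    let j : P ⟶ X ⊗ P := CartesianMonoidalCategory.lift (Motives.toSpecOver P ≫ x₀) (𝟙 P)
    have hj : j ≫ snd X P = 𝟙 P := CartesianMonoidalCategory.lift_snd _ _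
    have hρj : complexBetti.map j (2 * r) (complexBetti.map (snd X P) (2 * r) ρ) = ρ := by
      rw [← CategoryTheory.comp_apply, ← complexBetti.map_comp, hj, complexBetti.map_id,
        CategoryTheory.id_apply]
    rw [← hρj, ← hy, map_zero]
  -- the class `c' = pr₁^* c ∪ pr₂^* ρ` on `V`: rational, of type `(p + r, p + r)`, hence algebraic
  set c' : complexBetti (X ⊗ P) (2 * (p + r)) :=
    cupProduct (show 2 * p + 2 * r = 2 * (p + r) by ring) (complexBetti.map (fst X P) (2 * p) c)
      (complexBetti.map (snd X P) (2 * r) ρ) with hc'def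
  have hc'rat : IsRationalClass c' := (hc.map _).cup _ (hρ.map _)
  have hc'typ : IsOfHodgeType (n + r) (X ⊗ P) (2 * (p + r)) (p + r) (p + r) c' :=
    cupPreservesHodgeType_holds' hV _ (hpp.map_of_isSmoothProjective hV hX (fst X P))
      (hρtyp.map_of_isSmoothProjective hV hP (snd X P))
  have halg : c' ∈ algebraicClasses (X ⊗ P) (p + r) := hprod c' hc'rat hc'typ
  -- `pr_{1*} c' ∈ Nᵖ H²ᵖ(X(ℂ); ℂ)` (Gysin maps and supports)
  have hpush : complexGysin μ hV hX (fst X P) (show 2 * (p + r) + 2 * n = 2 * p + 2 * (n + r) by ring)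
      c' ∈ algebraicClasses X p :=
    complexGysin_mem_supportedClasses hS μ hμ hV hX (fst X P) _ (by omega) halg
  -- `pr_{1*} c' = c ∪ pr_{1*} pr₂^* ρ = c ∪ λ · (s_t ≫ pr₁)_* 1 = λ c`
  have hone : complexGysin μ hV hX (fst X P) (show 2 * r + 2 * n = 0 + 2 * (n + r) by ring)
      (complexBetti.map (snd X P) (2 * r) ρ) = lam • singularCohomology.one ℂ (Motives.ComplexPoints X) := by
    rw [← hy, map_smul, ← LinearMap.comp_apply,
      ← complexGysin_comp hμ hX hV hX (Motives.sliceAt X t) (fst X P)]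
    simp only [Motives.sliceAt_fst]
    rw [complexGysin_id hμ hX 0, LinearMap.id_apply]
  have hcc : complexGysin μ hV hX (fst X P) (show 2 * (p + r) + 2 * n = 2 * p + 2 * (n + r) by ring)
      c' = lam • c := by
    rw [hc'def, complexGysin_cup hμ hV hX (fst X P) _ _
      (show 2 * r + 2 * n = 0 + 2 * (n + r) by ring) (Nat.add_zero (2 * p)), hone,
      LinearMap.map_smul, cupProduct_one]
  rw [hcc] at hpush
  have h := Submodule.smul_mem _ lam⁻¹ hpush
  rwa [smul_smul, inv_mul_cancel₀ hlam, one_smul] at h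

/-- **The square step.** Let `Y` be a smooth projective `d`-fold, `T` ANY smooth projective
`p`-fold, and suppose every rational `(d + p, d + p)`-class of degree `2(d + p)` on the square
`(Y × T) × (Y × T)` of the `(d + p)`-fold `Y × T` is algebraic. Then every rational `(p, p)`-class
`c` on `Y` is algebraic. For `d = 0` this is `Arapura2006.hodgeConjectureFor_of_dim_zero`; else:
transport the hypothesis along `τ : ((Y × T) × T) × Y ≅ (Y × T) × (Y × T)`
(`forall_hodgeClass_mem_algebraicClasses_iff_of_iso`), apply the product step
`mem_algebraicClasses_of_prod_of_topDegree` at the last factor `Y` to the rational `(p,p)`-class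
`pr₁^* pr₁^* c` on `(Y × T) × T` (degrees: `2p + 2d = 2(d + p)`), and descend along the two first
projections (`mem_algebraicClasses_left_of_map_fst_mem`). The index `M = 2(d + p)` is free.
[cite: BrosnanFangNiePearlstein2009, §6 Lemma 48] [cite: VoisinHodgeI2002, §11.3.3 Lemma 11.41] -/
theorem mem_algebraicClasses_of_square
    {d : ℕ} {Y : Motives.SchemeOver ℂ} (hY : Motives.IsSmoothProjective d Y)
    {p : ℕ} {T : Motives.SchemeOver ℂ} (hT : Motives.IsSmoothProjective p T)
    {M : ℕ} (hM : d + p + (d + p) = M)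
    (hsq : ∀ Φ : complexBetti ((Y ⊗ T) ⊗ (Y ⊗ T)) (2 * (d + p)), IsRationalClass Φ →
      IsOfHodgeType M ((Y ⊗ T) ⊗ (Y ⊗ T)) (2 * (d + p)) (d + p) (d + p) Φ →
        Φ ∈ algebraicClasses ((Y ⊗ T) ⊗ (Y ⊗ T)) (d + p))
    (c : complexBetti Y (2 * p)) (hc : IsRationalClass c) (hpp : IsOfHodgeType d Y (2 * p) p p c) :
    c ∈ algebraicClasses Y p := by
  subst hM
  rcases Nat.eq_zero_or_pos d with rfl | hd
  · exact (Arapura2006.hodgeConjectureFor_of_dim_zero hY).2 p c hc hpp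
  -- `X = Y × T`, a `(d + p)`-fold; `X × T`; `W = (X × T) × Y ≅ X × X`
  have hX : Motives.IsSmoothProjective (d + p) (Y ⊗ T) :=
    Motives.IsSmoothProjective.tensor_holds hY hT
  have hXT : Motives.IsSmoothProjective (d + p + p) ((Y ⊗ T) ⊗ T) :=
    Motives.IsSmoothProjective.tensor_holds hX hT
  let τ : ((Y ⊗ T) ⊗ T) ⊗ Y ≅ (Y ⊗ T) ⊗ (Y ⊗ T) :=
    α_ (Y ⊗ T) T Y ≪≫ whiskerLeftIso (Y ⊗ T) (β_ T Y)
  -- the square hypothesis, transported to `W` along `τ`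
  have hW := (forall_hodgeClass_mem_algebraicClasses_iff_of_iso τ (d + p)).2 hsq
  -- the product step at the factor `Y` of `W` (top class of `Y`, `d ≥ 1`): `pr₁^* pr₁^* c` is algebraic
  have halg : complexBetti.map (fst (Y ⊗ T) T) (2 * p) (complexBetti.map (fst Y T) (2 * p) c) ∈
      algebraicClasses ((Y ⊗ T) ⊗ T) p :=
    mem_algebraicClasses_of_prod_of_topDegree hXT hY hd (q := d + p) (N := d + p + (d + p))
      (Nat.add_comm p d) (by omega) hW _ ((hc.map _).map _)
      ((hpp.map_of_isSmoothProjective hX hY (fst Y T)).map_of_isSmoothProjective hXT hX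
        (fst (Y ⊗ T) T))
  -- descent along the two first projections
  exact mem_algebraicClasses_left_of_map_fst_mem hY hT
    (mem_algebraicClasses_left_of_map_fst_mem hX hT halg)

/-- **`SquareHodge N`** — the Hodge conjecture for the squares `X × X` of smooth projective complex
`N`-folds `X`, in the single degree `2N = 2 dim X`: every rational class of Hodge type `(N, N)` in
`H^{2N}((X × X)(ℂ); ℂ)` is algebraic (lies in `N^N H^{2N}`, the span of the classes supported on
closed algebraic subsets of codimension `≥ N`). Informally: every Hodge class among the
degree-preserving self-correspondences `⊕ᵢ End(Hⁱ(X))` is algebraic.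
[cite: Deligne2000, §1] [cite: VoisinHodgeI2002, §11.3.3 Lemma 11.41] -/
@[conjecture] def SquareHodge (N : ℕ) : Prop :=
  ∀ ⦃X : Motives.SchemeOver ℂ⦄, Motives.IsSmoothProjective N X →
    ∀ c : complexBetti (X ⊗ X) (2 * N), IsRationalClass c →
      IsOfHodgeType (2 * N) (X ⊗ X) (2 * N) N N c → c ∈ algebraicClasses (X ⊗ X) N

/-- Specialisation: the Hodge conjecture implies `SquareHodge N` (`X × X` is smooth projective of
dimension `2N`, `IsSmoothProjective.tensor_holds`). [cite: Deligne2000, §1] -/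
theorem squareHodge_of_hodgeConjecture (h : _root_.HodgeConjecture) (N : ℕ) : SquareHodge N := by
  intro X hX c hc hpp
  have hXX : Motives.IsSmoothProjective (N + N) (X ⊗ X) := Motives.IsSmoothProjective.tensor_holds hX hX
  rw [← two_mul] at hXX
  exact (h hXX).2 N c hc hpp

/-- Specialisation: `MiddleHodge N` (all `2N`-folds, middle degree) implies `SquareHodge N` (the
`2N`-folds `X × X`). [cite: Deligne2000, §1] -/
theorem squareHodge_of_middleHodge {N : ℕ} (h : MiddleHodge N) : SquareHodge N := by
  intro X hX c hc hpp
  have hXX : Motives.IsSmoothProjective (N + N) (X ⊗ X) := Motives.IsSmoothProjective.tensor_holds hX hX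
  rw [← two_mul] at hXX
  exact h hXX c hc hpp

/-- **`SquareHodge N` decides codimension `p` on `d`-folds whenever `d + p ≤ N`.** For a rational
`(p,p)`-class `c` on the smooth projective `d`-fold `Y`: with `e = N - d - p`, `pr₁^* c` on the
`(d + e)`-fold `Y × ℙᵉ` is algebraic by the square step `mem_algebraicClasses_of_square` applied with
`T = ℙᵖ` to the `N`-fold `(Y × ℙᵉ) × ℙᵖ`, and `c` is algebraic by descent along `pr₁`
(`mem_algebraicClasses_left_of_map_fst_mem`).
[cite: BrosnanFangNiePearlstein2009, §6 Lemma 48] [cite: VoisinHodgeI2002, §11.3.3 Lemma 11.41] -/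
theorem mem_algebraicClasses_of_squareHodge {N : ℕ} (h : SquareHodge N)
    {d : ℕ} {Y : Motives.SchemeOver ℂ} (hY : Motives.IsSmoothProjective d Y) {p : ℕ}
    (hdp : d + p ≤ N) (c : complexBetti Y (2 * p)) (hc : IsRationalClass c)
    (hpp : IsOfHodgeType d Y (2 * p) p p c) : c ∈ algebraicClasses Y p := by
  obtain ⟨e, rfl⟩ : ∃ e, N = d + e + p := ⟨N - d - p, by omega⟩
  have hE : Motives.IsSmoothProjective e (Motives.projectiveSpace e ℂ) :=
    Motives.isSmoothProjective_projectiveSpace_holds ℂ e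
  have hT : Motives.IsSmoothProjective p (Motives.projectiveSpace p ℂ) :=
    Motives.isSmoothProjective_projectiveSpace_holds ℂ p
  have hYE : Motives.IsSmoothProjective (d + e) (Y ⊗ Motives.projectiveSpace e ℂ) :=
    Motives.IsSmoothProjective.tensor_holds hY hE
  have hYET : Motives.IsSmoothProjective (d + e + p)
      ((Y ⊗ Motives.projectiveSpace e ℂ) ⊗ Motives.projectiveSpace p ℂ) :=
    Motives.IsSmoothProjective.tensor_holds hYE hT
  have halg : complexBetti.map (fst Y (Motives.projectiveSpace e ℂ)) (2 * p) c ∈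
      algebraicClasses (Y ⊗ Motives.projectiveSpace e ℂ) p :=
    mem_algebraicClasses_of_square hYE hT (M := 2 * (d + e + p)) (by ring) (h hYET) _ (hc.map _)
      (hpp.map_of_isSmoothProjective hYE hY (fst Y (Motives.projectiveSpace e ℂ)))
  exact mem_algebraicClasses_left_of_map_fst_mem hY hE halg

/-- **`SquareHodge N` gives the Hodge conjecture for every smooth projective variety of dimension
`d ≤ N/2`** (all degrees: codimension `p ≤ d` by `mem_algebraicClasses_of_squareHodge`, and
`H²ᵖ = 0` for `p > d`, `subsingleton_complexBetti`). [cite: Deligne2000, §1]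
[cite: BrosnanFangNiePearlstein2009, §6 Lemma 48] -/
theorem hodgeConjectureFor_of_squareHodge {N : ℕ} (h : SquareHodge N)
    {d : ℕ} {Y : Motives.SchemeOver ℂ} (hY : Motives.IsSmoothProjective d Y) (hd : 2 * d ≤ N) :
    HodgeConjectureFor d Y := by
  refine ⟨nonempty_hodgeModel_holds hY, fun p c hc hpp ↦ ?_⟩
  by_cases hp : p ≤ d
  · exact mem_algebraicClasses_of_squareHodge h hY (by omega) c hc hpp
  · haveI := subsingleton_complexBetti hY (k := 2 * p) (by omega)
    rw [Subsingleton.elim c 0]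
    exact Submodule.zero_mem _

/-- `SquareHodge N` for all `N` implies the Hodge conjecture (`N = 2 dim Y` suffices for `Y`).
[cite: Deligne2000, §1] [cite: BrosnanFangNiePearlstein2009, §6 Lemma 48] -/
theorem hodgeConjecture_of_forall_squareHodge (h : ∀ N, SquareHodge N) : _root_.HodgeConjecture :=
  fun d _ hY ↦ hodgeConjectureFor_of_squareHodge (h (2 * d)) hY le_rfl

/-- **The square form of the summit**: `HodgeConjecture ↔ ∀ N, SquareHodge N` — the Hodge conjecture
is equivalent to its instances on self-products `X × X` in the single degree `2 dim X`.
[cite: Deligne2000, §1] [cite: BrosnanFangNiePearlstein2009, §6 Lemma 48]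
[cite: VoisinHodgeI2002, §11.3.3 Lemma 11.41] -/
theorem hodgeConjecture_iff_forall_squareHodge : _root_.HodgeConjecture ↔ ∀ N, SquareHodge N :=
  ⟨squareHodge_of_hodgeConjecture, hodgeConjecture_of_forall_squareHodge⟩

/-- **From infinitely many levels**: `HodgeConjecture ↔ ∀ N₀, ∃ N ≥ N₀, SquareHodge N`
(`SquareHodge N` settles every variety of dimension `≤ N/2`). [cite: Deligne2000, §1]
[cite: BrosnanFangNiePearlstein2009, §6 Lemma 48] -/
theorem hodgeConjecture_iff_frequently_squareHodge :
    _root_.HodgeConjecture ↔ ∀ N₀ : ℕ, ∃ N, N₀ ≤ N ∧ SquareHodge N := by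
  refine ⟨fun h N₀ ↦ ⟨N₀, le_rfl, squareHodge_of_hodgeConjecture h N₀⟩, fun h d Y hY ↦ ?_⟩
  obtain ⟨N, hN, hsq⟩ := h (2 * d)
  exact hodgeConjectureFor_of_squareHodge hsq hY hN

/-- **Squares versus the middle-degree chain**: `SquareHodge N → MiddleHodge m` whenever `3m ≤ N`
(`2m`-folds, codimension `m`: `2m + m ≤ N`); with `squareHodge_of_middleHodge`
(`MiddleHodge N → SquareHodge N`) the two chains interleave. In particular `SquareHodge 6` implies
the Hodge conjecture for `(2,2)`-classes on fourfolds. [cite: BrosnanFangNiePearlstein2009, §6 Lemma 48] -/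
theorem middleHodge_of_squareHodge {N m : ℕ} (h : SquareHodge N) (hm : 3 * m ≤ N) : MiddleHodge m :=
  fun _ hX c hc hpp ↦ mem_algebraicClasses_of_squareHodge h hX (by omega) c hc hpp

/-- `SquareHodge 0` and `SquareHodge 1` are theorems: `MiddleHodge 0` (points) and `MiddleHodge 1`
(Lefschetz `(1,1)` on the surfaces `C × C`), via `squareHodge_of_middleHodge`. The first open level
is `N = 2` (self-products of surfaces). [cite: VoisinHodgeI2002, §11.3.3] -/
theorem squareHodge_of_le_one {N : ℕ} (hN : N ≤ 1) : SquareHodge N :=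
  squareHodge_of_middleHodge (middleHodge_of_le_one hN)

end Summit.HodgeConjecture.HodgeConjecture.Theorems.SoloBlind

end
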